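import Summits.BirchSwinnertonDyer.BirchSwinnertonDyer.Theorems.KolyvaginRankRigidityAtTwoChebotarevOneClassAtTwoAlgebra
import Summits.BirchSwinnertonDyer.BirchSwinnertonDyer.Theorems.GenusKolyvaginAtTwoEquivariantChebotarevAtTwoOffDiscField
import Literature.NumberTheory.EllipticCurves.HeegnerPointsKolyvaginPrimaryCebotarevFrobeniusProofs
import Literature.NumberTheory.EllipticCurves.HeegnerPointsKolyvaginPrimaryCongruenceProofs
import Literature.NumberTheory.EllipticCurves.IsogenyFrobeniusTraceProofs
import Literature.NumberTheory.EllipticCurves.HeegnerPointsOfConductor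
import Literature.NumberTheory.EllipticCurves.TorsionFrobeniusProofs
import Literature.NumberTheory.Automorphic.TunnellLemma
import HarnessLib

/-!
# Crux V2♭ `KolyvaginCorankLowerBoundAtTwo` (stmt-BirchSwinnertonDyer-24623), line `kolyvagin_depth_split`,
# stub T5⁺, input T5b(a′) WITH THE MARGIN, part 1: McCallum's Čebotarev step with TWO LEVELS
# (helper, PROVED; width seat `bsd-line-krr2-p2` g6)

Sequel to `…ChebotarevOneClassAtTwoAlgebra` / `…ChebotarevOneClassAtTwo`. The window step T5b of
the lead's skeleton works with the class `c_M(n)` (level `2^M`) but needs the NEW Kolyvagin prime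
`q` to have index `M(q) ≥ M + 1` (the margin of T1, `2^{M+1} ∣ q + 1`, `2^{M+1} ∣ a_q`): Čebotarev
must be run in `K(E[2^{M+1}])` while the local criterion is read for a class with `E[2^M]`
coefficients. This file proves exactly that, for any `M' ≥ M`:

* `torsionFixing_le_of_dvd`, `two_zsmul_eq_zero_of_h1Eval_eq_zero_of_dvd` — Sah at `2` for the
  restriction to the SMALLER group `Γ_{K(E[2^{M'}])}` (its kernel is still killed by `2`: the
  element acting as `-1` on `E[2^{M'}]` acts as `-1` on `E[2^M]`);
* `exists_kolyvaginPrime_gt_of_galoisElement_of_le` — the tree's `p`-generic Steps C–G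
  (`exists_kolyvaginPrime_gt_of_galoisElement`, McCallum Prop. 3.1) with TWO levels: classes at
  `p^M`, `ρ ∈ Γ_{K(E[p^{M'}])}`, `Frob ℓ = Frob ∞` on `K(E[p^{M'}])`, local criterion at `p^M`;
* `exists_gt_hasGoodReductionAt`, `le_kolyvaginIndex_of_frobEqFrobInfty`,
  `exists_kolyvaginPrime_gt_le_kolyvaginIndex` — reading `M' ≤ M(ℓ)` off `Frob ℓ = Frob ∞` above
  the bad primes, and the plain existence of Kolyvagin primes at `2` of every index (unconditional:
  the Čebotarev density theorem is the tree's proved `Automorphic.chebotarev_artinRep_of_galoisSide`).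

The sequel `…ChebotarevOneClassAtTwoShifted.lean` assembles the one-class theorem one level up.
HONEST FRAMING: helper (`--supports` 24623); it is input (a′) of the window step only — the
duality half (b′) of T5b and strong non-vanishing T5a are untouched; T5⁺ and V2♭ are NOT proved;
BSD is not proved by any of this.

References: [McCallumLMS1991] §3 Prop. 3.1, Cor. 3.2; [GrossLMS1991] §9; [Kolyvagin1991MathAnn] §2
(ref. [1] Prop. 8); [WZhang2014] Notations (xii); [TateGCFT1967] §2.4; [Sah1968] Prop. 2.7 (b).
-/

set_option autoImplicit false
-- the Theorems namespace of this sub repeats the summit name by design (D-0017 nested layout)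
set_option linter.dupNamespace false

noncomputable section

open scoped Classical Pointwise

namespace Summit.BirchSwinnertonDyer.BirchSwinnertonDyer.Theorems.KolyvaginLowerBoundAtTwo

open WeierstrassCurve Field NumberField IsDedekindDomain
open Literature.NumberTheory.GaloisRepresentations Literature.NumberTheory.EllipticCurves
open Literature.NumberTheory Rat.HeightOneSpectrum

universe u

/-! ### Level bookkeeping and Sah at `2` for the smaller group -/

/-- `Γ_{K(E[n'])} ≤ Γ_{K(E[n])}` for `n ∣ n'` (`E[n] ⊆ E[n']`). [folklore] -/
theorem torsionFixing_le_of_dvd {k : Type u} [Field k] (V : WeierstrassCurve k) {n n' : ℤ}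
    (h : n ∣ n') : torsionFixing V n' ≤ torsionFixing V n := by
  intro ρ hρ
  rw [mem_torsionFixing_iff] at hρ ⊢
  intro P
  have := hρ (AddSubgroup.inclusion (V.geomTorsion_le_of_dvd h) P)
  apply Subtype.ext
  exact congrArg (fun x : geomTorsion V n' ↦ (x : geomPoints V)) this

/-- **Sah at `2`, two levels.** If `n ∣ n'`, some `z ∈ Γ_K` acts as `-1` on `E[n']`, and a
class `x ∈ H¹(K, E[n])` vanishes on `Γ_{K(E[n'])}`, then `2x = 0` (the proof of
`two_zsmul_eq_zero_of_h1Eval_eq_zero` with the commutator `z⁻¹g⁻¹zg ∈ Γ_{K(E[n'])}`).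
[cite: GrossLMS1991, Prop. 9.1 (proof)] [cite: Sah1968, Prop. 2.7 (b)] -/
theorem two_zsmul_eq_zero_of_h1Eval_eq_zero_of_dvd {k : Type u} [Field k] (V : WeierstrassCurve k)
    {n n' : ℤ} (hnn' : n ∣ n') {z : absoluteGaloisGroup k}
    (hz' : ∀ P : geomTorsion V n', z • P = -P) {x : galH1Torsion V n}
    (hx : ∀ ρ ∈ torsionFixing V n', h1Eval V n x ρ = 0) : (2 : ℤ) • x = 0 := by
  have hz : ∀ P : geomTorsion V n, z • P = -P := fun P ↦ by
    have := hz' (AddSubgroup.inclusion (V.geomTorsion_le_of_dvd hnn') P)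
    apply Subtype.ext
    exact congrArg (fun x : geomTorsion V n' ↦ (x : geomPoints V)) this
  rw [← oneCocycleClass_reprCocycle V n x, two_zsmul, ← oneCocycleClass_add]
  set φ := reprCocycle V n x with hφ
  refine (oneCocycleClass_eq_zero_iff _ (φ + φ)).mpr ⟨-(φ.1 z), fun g ↦ ?_⟩
  -- `n₀ = z⁻¹ g⁻¹ z g` acts trivially on `E[n']`
  have hn₀ : z⁻¹ * g⁻¹ * z * g ∈ torsionFixing V n' := by
    refine (mem_torsionFixing_iff V n').mpr fun P ↦ ?_
    have hz'' : ∀ Q : geomTorsion V n', z⁻¹ • Q = -Q := fun Q ↦ by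
      have := hz' (z⁻¹ • Q)
      rw [smul_inv_smul] at this
      rw [← neg_neg (z⁻¹ • Q), ← this]
    rw [mul_smul, mul_smul, mul_smul, hz', smul_neg, hz'', neg_neg, inv_smul_smul]
  have hzg : z * g = g * z * (z⁻¹ * g⁻¹ * z * g) := by group
  have h1 := φ.2 z g
  have h2 := φ.2 (g * z) (z⁻¹ * g⁻¹ * z * g)
  have h3 := φ.2 g z
  rw [discreteTopRep_ρ_apply] at h1 h2 h3
  have h4 : φ.1 (z⁻¹ * g⁻¹ * z * g) = 0 := hx _ hn₀
  rw [← hzg, h1, h4, smul_zero, add_zero, h3, hz] at h2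
  have key : φ.1 g + φ.1 g = φ.1 z - g • φ.1 z := by
    rw [← sub_eq_zero] at h2 ⊢
    have e : φ.1 g + φ.1 g - (φ.1 z - g • φ.1 z) = -(φ.1 z + -φ.1 g - (φ.1 g + g • φ.1 z)) := by
      abel
    rw [e, h2, neg_zero]
  change (φ.1 + φ.1) g = _
  rw [ContinuousMap.add_apply, key, discreteTopRep_ρ_apply, smul_neg]
  abel

/-! ### McCallum's Čebotarev step with two levels (the tree's Steps C–G) -/

section TwoLevel

variable {W : WeierstrassCurve ℚ} {K : Type u} [Field K] [NumberField K]

set_option maxHeartbeats 1600000 in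
/-- **Two-level form of the tree's `exists_kolyvaginPrime_gt_of_galoisElement`** (McCallum 1991
Prop. 3.1, Čebotarev step): the classes `c_i` live in `H¹(K, E[p^M])`, the Galois element `ρ`
fixes `E[p^{M'}]` for some `M' ≥ M`, and the Kolyvagin prime produced has `Frob ℓ = Frob ∞` on the
LARGER field `K(E[p^{M'}])` (so `M' ≤ M(ℓ)`), while McCallum's local criterion (3)
`x_λ = 0 ⟺ [x, (ρm)^τ(ρm)] = 0` is read at level `p^M`, for `m ∈ 𝒩 ∩ Γ_{K(E[p^{M'}])}`. The
proof is the tree's Steps C–G verbatim with the open set `c₀·res(ρ(𝒩 ∩ Γ_{K(E[p^{M'}])}))`.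
This is the "Čebotarev one level up" that Kolyvagin classes at `2` need (margin `M + 1 ≤ M(ℓ)`).
[cite: McCallumLMS1991, §3 Prop. 3.1 (proof), (3)] [cite: TateGCFT1967, §2.4] -/
theorem exists_kolyvaginPrime_gt_of_galoisElement_of_le (hC : Automorphic.chebotarev_artinRep)
    {N : ℕ} [NeZero N] [W.IsElliptic] (hK : IsImaginaryQuadratic K) {p : ℕ} (hp : p.Prime)
    {M M' : ℕ} (hMM' : M ≤ M')
    {c : K ≃ₐ[ℚ] K} {c₀ : absoluteGaloisGroup ℚ} (hc₀ : IsComplexConjugation (Rat.castHom ℝ) c₀)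
    (ht : IsLiftOfAut c (absGaloisTransport (K := ℚ) (L := K) c₀).toRingEquiv)
    (hinv : ∀ x, (absGaloisTransport (K := ℚ) (L := K) c₀).toRingEquiv
      ((absGaloisTransport (K := ℚ) (L := K) c₀).toRingEquiv x) = x)
    {ι : Type*} [Fintype ι] (cs : ι → galH1Torsion (W.baseChange K) ((p ^ M : ℕ) : ℤ))
    {ρ : absoluteGaloisGroup K} (hρT' : ρ ∈ torsionFixing (W.baseChange K) ((p ^ M' : ℕ) : ℤ))
    (b : ℕ) :
    ∃ ℓ : ℕ, b < ℓ ∧ ℓ.Prime ∧ ¬ ℓ ∣ N ∧ ¬ ((ℓ : ℤ) ∣ NumberField.discr K) ∧ ℓ ≠ p ∧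
      (Ideal.span {(ℓ : 𝓞 K)}).IsPrime ∧ FrobEqFrobInfty W K (p ^ M') ℓ ∧
      ∃ m ∈ evalKer (W.baseChange K) ((p ^ M : ℕ) : ℤ) cs,
        m ∈ torsionFixing (W.baseChange K) ((p ^ M' : ℕ) : ℤ) ∧
        ∀ x ∈ AddSubgroup.closure (Set.range cs),
          ∀ v : HeightOneSpectrum (𝓞 K), (ℓ : 𝓞 K) ∈ v.asIdeal →
            (x ∈ (W.baseChange K).torsionLocalKer (v.adicCompletion K) ((p ^ M : ℕ) : ℤ) ↔
              h1Eval (W.baseChange K) ((p ^ M : ℕ) : ℤ) x (ht.conjGalCMH (ρ * m) * (ρ * m)) = 0) := by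
  classical
  haveI : Fact p.Prime := ⟨hp⟩
  haveI : Algebra.IsQuadraticExtension ℚ K := ⟨hK.1⟩
  haveI : IsTotallyComplex K := hK.2
  have hn0 : ((p ^ M : ℕ) : ℤ) ≠ 0 := by exact_mod_cast pow_ne_zero M hp.ne_zero
  have hn0' : ((p ^ M' : ℕ) : ℤ) ≠ 0 := by exact_mod_cast pow_ne_zero M' hp.ne_zero
  have hle : torsionFixing (W.baseChange K) ((p ^ M' : ℕ) : ℤ) ≤
      torsionFixing (W.baseChange K) ((p ^ M : ℕ) : ℤ) :=
    torsionFixing_le_of_dvd (W.baseChange K) (by exact_mod_cast Nat.pow_dvd_pow p hMM')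
  have hρT : ρ ∈ torsionFixing (W.baseChange K) ((p ^ M : ℕ) : ℤ) := hle hρT'
  -- ### Step C: the finite exceptional set of places of `ℚ`
  have hbad : ((W.baseChange K).badPlaces (𝓞 K)).Finite :=
    (W.baseChange K).finite_badPlaces_holds (𝓞 K)
  choose T hTfin hT using fun i ↦
    exists_finite_forall_mem_unramifiedKer (W.baseChange K) hn0 (cs i)
  set B : Finset ℕ := {p} ∪ N.primeFactors ∪ (NumberField.discr K).natAbs.primeFactors ∪
    Finset.range (b + 1) with hB
  set S₁ : Set (HeightOneSpectrum (𝓞 ℚ)) := {v | ∃ q ∈ B, q.Prime ∧ (q : 𝓞 ℚ) ∈ v.asIdeal}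
    with hS₁
  set S₂ : Set (HeightOneSpectrum (𝓞 ℚ)) := {v | ¬ Algebra.IsUnramifiedIn (𝓞 K) v.asIdeal}
    with hS₂
  set S₃ : Set (HeightOneSpectrum (𝓞 ℚ)) :=
    (fun w : HeightOneSpectrum (𝓞 K) ↦ w.under (𝓞 ℚ)) ''
      ((W.baseChange K).badPlaces (𝓞 K) ∪ ⋃ i, T i) with hS₃
  have hS₁fin : S₁.Finite := by
    have : S₁ ⊆ ⋃ q ∈ (B.filter Nat.Prime), {v | (q : 𝓞 ℚ) ∈ v.asIdeal} := by
      intro v ⟨q, hqB, hq, hqv⟩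
      simp only [Set.mem_iUnion, Finset.mem_filter]
      exact ⟨q, ⟨hqB, hq⟩, hqv⟩
    refine Set.Finite.subset (Set.Finite.biUnion (Finset.finite_toSet _) fun q hq ↦ ?_) this
    rw [Finset.coe_filter, Set.mem_setOf_eq] at hq
    have hsub : {v : HeightOneSpectrum (𝓞 ℚ) | (q : 𝓞 ℚ) ∈ v.asIdeal}.Subsingleton :=
      fun v hv v' hv' ↦ HeightOneSpectrum.eq_of_natCast_mem_rat hq.2 hv hv'
    exact hsub.finite
  have hS₂fin : S₂.Finite := finite_setOf_not_isUnramifiedIn ℚ K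
  have hS₃fin : S₃.Finite :=
    (hbad.union (Set.finite_iUnion fun i ↦ hTfin i)).image _
  set S := S₁ ∪ S₂ ∪ S₃ with hSdef
  have hSfin : S.Finite := (hS₁fin.union hS₂fin).union hS₃fin
  -- ### Step D: Čebotarev in `Γ_ℚ`: a Frobenius in the open set `c₀ · res(ρ 𝒩)`
  have h𝒩open : IsOpen ((evalKer (W.baseChange K) ((p ^ M : ℕ) : ℤ) cs ⊓
      torsionFixing (W.baseChange K) ((p ^ M' : ℕ) : ℤ) :
      Subgroup (absoluteGaloisGroup K)) : Set (absoluteGaloisGroup K)) :=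
    (isOpen_evalKer (W.baseChange K) _ cs (isOpen_torsionFixing (W.baseChange K) hn0)).inter
      (isOpen_torsionFixing (W.baseChange K) hn0')
  obtain ⟨O, hO⟩ : ∃ O : Set (absoluteGaloisGroup ℚ), O = (fun γ ↦ c₀ * γ) ''
      (absGaloisRestrict ℚ K '' ((fun m ↦ ρ * m) ''
        ((evalKer (W.baseChange K) ((p ^ M : ℕ) : ℤ) cs ⊓
          torsionFixing (W.baseChange K) ((p ^ M' : ℕ) : ℤ) : Subgroup (absoluteGaloisGroup K)) :
          Set (absoluteGaloisGroup K)))) := ⟨_, rfl⟩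
  have hOopen : IsOpen O := by
    rw [hO]
    refine (Homeomorph.mulLeft c₀).isOpenMap _ (isOpenMap_absGaloisRestrict K _ ?_)
    exact (Homeomorph.mulLeft ρ).isOpenMap _ h𝒩open
  have hOne : O.Nonempty :=
    ⟨c₀ * absGaloisRestrict ℚ K (ρ * 1), hO ▸ ⟨_, ⟨_, ⟨1, Subgroup.one_mem _, rfl⟩, rfl⟩, rfl⟩⟩
  obtain ⟨γ, hγO, v, hvS, 𝔓₀, h𝔓₀, hγ⟩ :=
    (absoluteGaloisGroup.frobenius_dense hC ℚ S hSfin).inter_open_nonempty O hOopen hOne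
  rw [hO] at hγO
  obtain ⟨_, ⟨_, ⟨m, hm, rfl⟩, rfl⟩, rfl⟩ := hγO
  let g := ρ * m
  have hgT' : g ∈ torsionFixing (W.baseChange K) ((p ^ M' : ℕ) : ℤ) := mul_mem hρT' hm.2
  have hgT : g ∈ torsionFixing (W.baseChange K) ((p ^ M : ℕ) : ℤ) := hle hgT'
  -- ### Step E: the rational prime `ℓ` under `v`
  obtain ⟨ℓ, hℓ, hℓv⟩ := exists_prime_natCast_mem v
  have hℓB : ℓ ∉ B := fun h ↦ hvS (Or.inl (Or.inl ⟨ℓ, h, hℓ, hℓv⟩))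
  simp only [hB, Finset.mem_union, Finset.mem_singleton, Nat.mem_primeFactors,
    Finset.mem_range, not_or] at hℓB
  obtain ⟨⟨⟨hℓp, hℓN⟩, hℓD⟩, hℓb⟩ := hℓB
  have hℓN' : ¬ ℓ ∣ N := fun h ↦ hℓN ⟨hℓ, h, NeZero.ne N⟩
  have hℓD' : ¬ ((ℓ : ℤ) ∣ NumberField.discr K) := fun h ↦
    hℓD ⟨hℓ, Int.natAbs_dvd_natAbs.mpr h |>.trans (by simp), by
      simp [NumberField.discr_ne_zero]⟩
  have hbℓ : b < ℓ := by omega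
  have hunr : Algebra.IsUnramifiedIn (𝓞 K) v.asIdeal := by
    by_contra h; exact hvS (Or.inl (Or.inr h))
  have hvS₃ : v ∉ S₃ := fun h ↦ hvS (Or.inr h)
  -- ### Step F: `ℓ` is inert, with a Frobenius `τ' = g^τ g` over `K`
  have hHi := index_range_absGaloisRestrict_eq_finrank ℚ K
  haveI hHn : ((absGaloisRestrict ℚ K).range).Normal :=
    Subgroup.normal_of_index_eq_two (hHi.trans hK.1)
  have hI := inertia_le_range_absGaloisRestrict_of_isUnramifiedIn (K := K) hunr h𝔓₀
  have hΦH : c₀ * absGaloisRestrict ℚ K g ∉ (absGaloisRestrict ℚ K).range := by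
    intro h
    apply hc₀.not_mem_range_absGaloisRestrict (L := K) IsTotallyComplex.isComplex
    change c₀ ∈ ((absGaloisRestrict ℚ K).range : Set (absoluteGaloisGroup ℚ))
    have h' : c₀ = c₀ * absGaloisRestrict ℚ K g * (absGaloisRestrict ℚ K g)⁻¹ := by group
    rw [SetLike.mem_coe, h']
    exact Subgroup.mul_mem _ h (Subgroup.inv_mem _ ⟨g, rfl⟩)
  obtain ⟨w, 𝔔, τ', hwv, hwuniq, -, h𝔔w, -, hτ', hresτ'⟩ :=
    exists_place_inert_of_not_mem_range (F := ℚ) (M := K) (hK.1 ▸ Nat.prime_two) hHn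
      (hHi.trans rfl) hunr h𝔓₀ hI hγ hΦH
  rw [hK.1, sq_eq_absGaloisRestrict_conjGal_mul hc₀ ht g] at hresτ'
  have hτ'eq : τ' = ht.conjGalCMH g * g := absGaloisRestrict_injective ℚ K hresτ'
  -- `ℓ ∈ w`, and `w` is the only place of `K` containing `ℓ`
  have hℓw : (ℓ : 𝓞 K) ∈ w.asIdeal := by
    have h1 : (ℓ : 𝓞 ℚ) ∈ (w.under (𝓞 ℚ)).asIdeal := by rw [hwv]; exact hℓv
    rw [HeightOneSpectrum.under_asIdeal, Ideal.under_def, Ideal.mem_comap, map_natCast] at h1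
    exact h1
  have hwuniq' : ∀ w' : HeightOneSpectrum (𝓞 K), (ℓ : 𝓞 K) ∈ w'.asIdeal → w' = w := by
    intro w' hw'
    apply hwuniq
    apply HeightOneSpectrum.eq_of_natCast_mem_rat hℓ _ hℓv
    rw [HeightOneSpectrum.under_asIdeal, Ideal.under_def, Ideal.mem_comap, map_natCast]
    exact hw'
  -- `(ℓ) = w` is prime
  have hspan : Ideal.span {(ℓ : 𝓞 K)} = w.asIdeal := by
    apply span_natCast_eq_of_unique hℓ w hwuniq'
    haveI : w.asIdeal.LiesOver v.asIdeal := ⟨by rw [← hwv]; rfl⟩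
    have hmap : v.asIdeal.map (algebraMap (𝓞 ℚ) (𝓞 K)) = Ideal.span {(ℓ : 𝓞 K)} := by
      rw [← span_natCast_rat_eq hℓ hℓv, Ideal.map_span, Set.image_singleton, map_natCast]
    have hne : v.asIdeal.map (algebraMap (𝓞 ℚ) (𝓞 K)) ≠ ⊥ := by
      rw [hmap, Ne, Ideal.span_singleton_eq_bot]; exact_mod_cast hℓ.ne_zero
    rw [← hmap, ← Ideal.IsDedekindDomain.ramificationIdx_eq_normalizedFactors_count v.asIdeal
      w.asIdeal hne]
    exact Ideal.ramificationIdx_eq_one_iff.mpr (hunr w.asIdeal w.isPrime inferInstance)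
  -- ### Step G: the local criterion at `w`, for every class in the span of the `c_i`
  have hwT : ∀ i, w ∉ T i := fun i h ↦ hvS₃ ⟨w, Or.inr (Set.mem_iUnion.mpr ⟨i, h⟩), hwv⟩
  have hloc : ∀ x ∈ AddSubgroup.closure (Set.range cs),
      (x ∈ (W.baseChange K).torsionLocalKer (w.adicCompletion K) ((p ^ M : ℕ) : ℤ) ↔
        h1Eval (W.baseChange K) ((p ^ M : ℕ) : ℤ) x (ht.conjGalCMH (ρ * m) * (ρ * m)) = 0) := by
    intro x hx
    haveI : CharZero (w.adicCompletion K) :=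
      charZero_of_injective_algebraMap (algebraMap K (w.adicCompletion K)).injective
    obtain ⟨𝔐, h𝔐⟩ := w.localPrimesAbove_nonempty
    set 𝔓w := w.primeBelow (closureEmb (K := K) (w.adicCompletion K)) 𝔐 with h𝔓w_def
    have h𝔓w : 𝔓w ∈ w.primesAbove := w.primeBelow_mem_primesAbove h𝔐
    obtain ⟨δ, hδ, hF⟩ :=
      HeightOneSpectrum.exists_isArithFrobAt_conj_of_mem_primesAbove_holds h𝔔w h𝔓w hτ'
    have hτ'T : τ' ∈ torsionFixing (W.baseChange K) ((p ^ M : ℕ) : ℤ) := by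
      rw [hτ'eq]; exact mul_mem (ht.conjGalCMH_mem_torsionFixing W hinv _ hgT) hgT
    have hFT : δ * τ' * δ⁻¹ ∈ torsionFixing (W.baseChange K) ((p ^ M : ℕ) : ℤ) :=
      (torsionFixing_normal (W.baseChange K) _).conj_mem _ hτ'T δ
    have hwbad : w ∉ (W.baseChange K).badPlaces (𝓞 K) := fun h ↦
      hvS₃ ⟨w, Or.inl h, hwv⟩
    have hpw : ((p : ℤ) : 𝓞 K) ∉ w.asIdeal := by
      rw [Int.cast_natCast]
      exact not_natCast_mem_of_prime_ne hℓ hp hℓp w hℓw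
    have hpMw : ((((p ^ M : ℕ) : ℤ)) : 𝓞 K) ∉ w.asIdeal := fun h ↦ by
      apply hpw
      rw [Int.cast_natCast, Nat.cast_pow] at h
      rw [Int.cast_natCast]
      exact w.isPrime.mem_of_pow_mem M h
    have hcrit := mem_torsionLocalKer_iff_h1Eval_eq_zero (W.baseChange K) ((p ^ M : ℕ) : ℤ) h𝔐 hF
      hFT (inertia_le_torsionFixing (W.baseChange K) hwbad hpMw _ h𝔐)
      (isOpen_torsionFixing (W.baseChange K) hn0)
      (torsionPointsMap_bijective (W.baseChange K) (w.adicCompletion K)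
        (pow_ne_zero M hp.ne_zero)).2 (x := x)
      ((AddSubgroup.closure_le _).mpr (Set.range_subset_iff.mpr fun i ↦ hT i w (hwT i) 𝔓w h𝔓w)
        hx)
    rw [hcrit, h1Eval_conj (W.baseChange K) _ _ δ hτ'T, smul_eq_zero_iff_eq, hτ'eq]
  -- ### Step H: assemble
  refine ⟨ℓ, hbℓ, hℓ, hℓN', hℓD', hℓp, hspan ▸ w.isPrime, ?_, m, hm.1, hm.2,
    fun x hx v' hv' ↦ ?_⟩
  · -- `Frob(ℓ) = Frob(∞)` on `K(E[p^{M'}])`: `γ = c₀ · res g` acts on `E(ℚ̄)[p^{M'}]`, `K` as `c₀`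
    refine ⟨v, 𝔓₀, c₀ * absGaloisRestrict ℚ K g, c₀, hℓv, h𝔓₀, hγ, hc₀, fun P ↦ ?_, fun e x ↦ ?_⟩
    · rw [mul_smul, absGaloisRestrict_smul_eq_of_mem_torsionFixing W hgT']
    · rw [mul_smul, absGaloisRestrict_smul_apply_eq g e x]
  · rw [hwuniq' v' hv']
    exact hloc x hx


/-! ### Kolyvagin primes at `2` of any index (existence) -/

/-- Above some bound every rational prime is a prime of good reduction for `E/ℚ` (finitely many
bad places, `finite_badPlaces_holds`). [cite: SilvermanAEC2009, VII.5] -/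
theorem exists_gt_hasGoodReductionAt (W : WeierstrassCurve ℚ) [W.IsElliptic] :
    ∃ B₀ : ℕ, ∀ ℓ : ℕ, ℓ.Prime → B₀ < ℓ →
      ∀ v : HeightOneSpectrum (𝓞 ℚ), (ℓ : 𝓞 ℚ) ∈ v.asIdeal → W.HasGoodReductionAt v := by
  classical
  have hbad₀ : (W.badPlaces (𝓞 ℚ)).Finite := W.finite_badPlaces_holds (𝓞 ℚ)
  refine ⟨hbad₀.toFinset.sup fun v ↦ (primesEquiv v : ℕ), fun ℓ hℓ hB v hv ↦ ?_⟩
  by_contra hbad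
  have hmem : v ∈ hbad₀.toFinset := by rw [Set.Finite.mem_toFinset]; exact hbad
  have h1 : (primesEquiv v : ℕ) ≤ hbad₀.toFinset.sup fun v ↦ (primesEquiv v : ℕ) :=
    Finset.le_sup (f := fun v ↦ (primesEquiv v : ℕ)) hmem
  rw [primesEquiv_eq_of_natCast_mem hℓ hv] at h1
  omega

/-- **`M' ≤ M(ℓ)` from `Frob ℓ = Frob ∞` on `K(E[2^{M'}])`** at a prime `ℓ ≠ 2` of good reduction:
`2^{M'} ∣ ℓ + 1` (Weil pairing) and `2^{M'} ∣ a_ℓ` (trace of Frobenius), the tree's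
`pow_dvd_add_one_of_frobEqFrobInfty` / `pow_dvd_frobeniusTraceAt_of_frobEqFrobInfty`.
[cite: GrossLMS1991, §3 (3.3)] [cite: WZhang2014, Notations (xii)] -/
theorem le_kolyvaginIndex_of_frobEqFrobInfty [W.IsElliptic] [W.IsGloballyMinimal] {M' : ℕ}
    (hM' : 1 ≤ M') {ℓ : ℕ} (hℓ : ℓ.Prime) (hℓ2 : ℓ ≠ 2) (h32 : FrobEqFrobInfty W K (2 ^ M') ℓ)
    (hgood : ∀ v : HeightOneSpectrum (𝓞 ℚ), (ℓ : 𝓞 ℚ) ∈ v.asIdeal → W.HasGoodReductionAt v) :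
    M' ≤ Zhang2014.kolyvaginIndex W 2 ℓ := by
  haveI : Fact (Nat.Prime 2) := ⟨Nat.prime_two⟩
  rw [Zhang2014.le_kolyvaginIndex_iff]
  refine ⟨pow_dvd_add_one_of_frobEqFrobInfty W (K := K) Nat.prime_two hM' hℓ hℓ2 h32, ?_⟩
  have h32' := h32
  obtain ⟨v₀, 𝔓₀, h, c₁, hℓv₀, -⟩ := h32'
  have h := pow_dvd_frobeniusTraceAt_of_frobEqFrobInfty W (K := K) Nat.prime_two hM' hℓ hℓ2 h32
    hℓv₀ (hgood v₀ hℓv₀)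
  rw [frobeniusTraceAt_eq_frobeniusTrace W v₀, primesEquiv_eq_of_natCast_mem hℓ hℓv₀] at h
  exact_mod_cast h

/-- **Kolyvagin primes at `2` of every index exist above every bound** (unconditional Čebotarev:
`Automorphic.chebotarev_artinRep_of_galoisSide`), for `K` imaginary quadratic with a non-trivial
automorphism. [cite: GrossLMS1991, §3 (3.1)–(3.3)] [cite: WZhang2014, Notations (xii)] -/
theorem exists_kolyvaginPrime_gt_le_kolyvaginIndex {N : ℕ} [NeZero N] [W.IsElliptic]
    [W.IsGloballyMinimal] (hK : IsImaginaryQuadratic K) {c : K ≃ₐ[ℚ] K} (hc : c ≠ 1)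
    {M' : ℕ} (hM' : 1 ≤ M') (b : ℕ) :
    ∃ ℓ : ℕ, b < ℓ ∧ Zhang2014.IsKolyvaginPrime N W K 2 ℓ ∧ M' ≤ Zhang2014.kolyvaginIndex W 2 ℓ ∧
      FrobEqFrobInfty W K (2 ^ M') ℓ := by
  classical
  obtain ⟨c₀, hc₀⟩ := exists_isComplexConjugation (Rat.castHom ℝ)
  have ht : IsLiftOfAut c (absGaloisTransport (K := ℚ) (L := K) c₀).toRingEquiv :=
    RatClosure.isLiftOfAut_absGaloisTransport_of_isImaginaryQuadratic hK hc hc₀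
  have hinv : ∀ x, (absGaloisTransport (K := ℚ) (L := K) c₀).toRingEquiv
      ((absGaloisTransport (K := ℚ) (L := K) c₀).toRingEquiv x) = x := fun x ↦
    RatClosure.absGaloisTransport_absGaloisTransport_of_sq_eq_one hc₀.sq_eq_one x
  obtain ⟨B₀, hB₀⟩ := exists_gt_hasGoodReductionAt W
  obtain ⟨ℓ, hbℓ, hℓ, hℓN, hℓD, hℓ2, hprime, h32, -⟩ :=
    exists_kolyvaginPrime_gt_of_galoisElement_of_le (W := W) (N := N)
      Automorphic.chebotarev_artinRep_of_galoisSide hK Nat.prime_two (le_refl M') hc₀ ht hinv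
      (fun i : Fin 0 ↦ (0 : galH1Torsion (W.baseChange K) ((2 ^ M' : ℕ) : ℤ)))
      (Subgroup.one_mem _) (max b B₀)
  have hidx : M' ≤ Zhang2014.kolyvaginIndex W 2 ℓ :=
    le_kolyvaginIndex_of_frobEqFrobInfty hM' hℓ hℓ2 h32
      (hB₀ ℓ hℓ (lt_of_le_of_lt (le_max_right _ _) hbℓ))
  exact ⟨ℓ, lt_of_le_of_lt (le_max_left _ _) hbℓ,
    ⟨hℓ, hℓN, hℓD, hℓ2, hprime, lt_of_lt_of_le (by omega) hidx⟩, hidx, h32⟩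

end TwoLevel

end Summit.BirchSwinnertonDyer.BirchSwinnertonDyer.Theorems.KolyvaginLowerBoundAtTwo

end
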